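import Literature.NumberTheory.Automorphic.UnitaryGroupSingularHeisenbergFibreIntegral
import Literature.NumberTheory.Automorphic.UnitaryGroupHeisenbergLatticeCollapse
import Mathlib.MeasureTheory.Integral.Prod
import Mathlib.MeasureTheory.Integral.Bochner.Set
import HarnessLib

/-!
# The `K`-average commutes with the singular bracket of `U(J₃)`: `∫_K b_T[f](y k) dμ_K = b_T[f^K](y)`
(Rogawski, *Automorphic Representations of Unitary Groups in Three Variables* (1990), §7.2, proof of Prop. 7.2.1,
(7.2.3)–(7.2.5), pp. 92–94: after `g = b k` the `K`-integral is absorbed into the test function,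
`f^K(y) = ∫_K f(k⁻¹ y k) dk`; §2.2 p. 13 «the sums are finite».)

Topic `NumberTheory/Automorphic`; namespace `Literature.NumberTheory.Automorphic.UnitaryGroup`. THEOREMS ONLY over
accepted tree modules: no definition, no named fact, no instance, no notation, no `sorry`. Brick (c5)(10) «THE
`K`-AVERAGE COMMUTES WITH THE SINGULAR BRACKET» of row (L5-iii-c) «PROP. 7.2.2 EVALUATION» of the T1-qs LAW 5 road
(`Cruxes/H413/Lines/F0_T1InnerFormTraceIdentity.lean`): ★ (F1) `exists_weight_iwasawa_kAverage_of_le` (BΛ) delivers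
`C · ∫_B w(b) • (∫_{K_U} b_T(b k) dμ_K) dμ_B`; this file rewrites the inner `K_U`-average as the SAME bracket of the
`K`-averaged test function `f^K := y ↦ ∫_K f(k⁻¹ y k) dμ_K` (the letters of ★ F0P3a-p08
`singularLine_kAverage_mem_schwartzBruhatAdele`, «`f^K` inside»), so that everything downstream (★
`UnitaryGroupSingularHeisenbergFibreBox` at `k = 1`, ★ `UnitaryGroupSingularTorusNormalForm`, ★
`UnitaryGroupSingularTorusPush`) runs ONCE, with `f^K` for `f`.

The bracket (landed letters of ★ `lintegral_weight_mul_enorm_singularBracket_lt_top`):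
`b_T[f](g) = Σ'_{n ∈ N_{γ₀}(F)∖1} f(g⁻¹ (n γ₀) g) − 1_{T < H(g)} · μ_Y(𝓕⁻)⁻¹ • ∫_{𝔸_E⁻} f(g⁻¹ (γ₀ n(w)) g) dμ_Y(w)`.

* §1 `conj_mul_mul_eq` (`(y k)⁻¹ X (y k) = k⁻¹ (y⁻¹ X y) k`); `exists_finset_forall_singularLattice_conj_eq_zero` — on the
  compact set of conjugators `y K` only finitely many lattice points `n γ₀` meet `tsupport f` (★
  `finite_setOf_exists_inv_mul_mul_mem_of_isCompact`); `hasCompactSupport_uncurry_centre_conj` and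
  `integrable_uncurry_centre_conj` — `(k, w) ↦ f(k⁻¹ y⁻¹ (γ₀ n(w)) y k)` is continuous of compact support on `K × 𝔸_E⁻`
  (★ `isClosedEmbedding_basePoint_mul_heisElt`).
* §2 HEAD **`integral_singularBracket_mul_eq_singularBracket_kAverage`**: for a compact subgroup `K ≤ G(𝔸_F)`
  preserving the Borel height (`H(y k) = H(y)`, ★ `borelHeight_mul_of_mem_comap_standardMaximalCompactGL` for `K_U`), a
  finite measure `μ_K` on it, `f` continuous of compact support and every `y ∈ G(𝔸_F)`:
  `∫_K b_T[f](y k) dμ_K(k) = b_T[f^K](y)`.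
* §3 `continuous_kConjAverage`, `hasCompactSupport_kConjAverage` — `f^K` is again continuous of compact support (the
  hypotheses of ★ `UnitaryGroupSingularHeisenbergFibreBox`).

## References
* J. D. Rogawski, *Automorphic Representations of Unitary Groups in Three Variables*, Ann. of Math. Stud. 123 (1990),
  §7.2 Prop. 7.2.1, (7.2.3)–(7.2.5), §2.2 [Rogawski1990].
* J. Arthur, *The trace formula in invariant form*, Ann. of Math. 114 (1981), §2 [Arthur1981TraceFormulaInvariantForm].
-/

set_option autoImplicit false

noncomputable section

open MeasureTheory NumberField IsDedekindDomain Topology Set Function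
open scoped ENNReal NNReal

namespace Literature.NumberTheory.Automorphic

namespace UnitaryGroup

variable {F E : Type} [Field F] [NumberField F] [Field E] [NumberField E] [Algebra F E]
  {c : E ≃ₐ[F] E}

/-! ## §1 Conjugation bookkeeping, finiteness of the lattice sum on `y K`, compact support of the centre family -/

/-- `(y k)⁻¹ X (y k) = k⁻¹ (y⁻¹ X y) k`. [cite: Rogawski1990, §7.2 (7.2.4) (p. 93)] -/
theorem conj_mul_mul_eq {G : Type*} [Group G] (y k X : G) : (y * k)⁻¹ * X * (y * k) = k⁻¹ * (y⁻¹ * X * y) * k := by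
  simp only [mul_inv_rev, mul_assoc]

/-- **Finitely many lattice points on a compact set of conjugators**: for `f` of compact support, a compact
`K ⊆ G(𝔸_F)` and `y ∈ G(𝔸_F)`, there is a finite set `S` of `n ∈ N_{γ₀}(F) ∖ 1` off which `f(k⁻¹ y⁻¹ (n γ₀) y k) = 0` for
ALL `k ∈ K` (`n γ₀ ∈ G(F)` discrete, ★ `finite_setOf_exists_inv_mul_mul_mem_of_isCompact`; `n ↦ n γ₀` injective).
[cite: Rogawski1990, §2.2 (p. 13)] [cite: Gelbart1975, (9.20)] -/
theorem exists_finset_forall_singularLattice_conj_eq_zero {V : Type*} [Zero V] [TopologicalSpace V]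
    (γ₀ : (quasiSplit F E c 3).arithmeticSubgroup) {KU : Set (quasiSplit F E c 3).Adelic} (hK : IsCompact KU)
    {f : (quasiSplit F E c 3).Adelic → V} (hf : HasCompactSupport f) (y : (quasiSplit F E c 3).Adelic) :
    ∃ S : Finset {n : ↥((adelicUnipotent F E c 3).subgroupOf (quasiSplit F E c 3).arithmeticSubgroup ⊓
        Subgroup.centralizer ({γ₀} : Set (quasiSplit F E c 3).arithmeticSubgroup)) // n ≠ 1},
      ∀ k ∈ KU, ∀ n, n ∉ S →
        f (k⁻¹ * (y⁻¹ * (((n.1 : (quasiSplit F E c 3).arithmeticSubgroup) * γ₀ : (quasiSplit F E c 3).arithmeticSubgroup) :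
          (quasiSplit F E c 3).Adelic) * y) * k) = 0 := by
  classical
  -- the compact set of conjugators `y K`
  have hC : IsCompact ((fun k : (quasiSplit F E c 3).Adelic => y * k) '' KU) := hK.image (continuous_const.mul continuous_id)
  have hfin := finite_setOf_exists_inv_mul_mul_mem_of_isCompact (F := F) (E := E) (c := c) (N := 3) hC hf.isCompact
  -- the injection `n ↦ n γ₀ ∈ G(F)`
  let ι : {n : ↥((adelicUnipotent F E c 3).subgroupOf (quasiSplit F E c 3).arithmeticSubgroup ⊓
        Subgroup.centralizer ({γ₀} : Set (quasiSplit F E c 3).arithmeticSubgroup)) // n ≠ 1} →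
      (quasiSplit F E c 3).arithmeticSubgroup := fun n => (n.1 : (quasiSplit F E c 3).arithmeticSubgroup) * γ₀
  have hinj : Set.InjOn ι (ι ⁻¹' {γ : (quasiSplit F E c 3).arithmeticSubgroup |
      ∃ y' ∈ (fun k : (quasiSplit F E c 3).Adelic => y * k) '' KU,
        y'⁻¹ * (γ : (quasiSplit F E c 3).Adelic) * y' ∈ tsupport f}) := by
    intro n _ n' _ h
    have h' : (n.1 : (quasiSplit F E c 3).arithmeticSubgroup) * γ₀ = (n'.1 : (quasiSplit F E c 3).arithmeticSubgroup) * γ₀ := h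
    exact Subtype.ext (Subtype.ext (mul_right_cancel h'))
  refine ⟨(hfin.preimage hinj).toFinset, fun k hk n hn => ?_⟩
  by_contra hne
  refine hn ((hfin.preimage hinj).mem_toFinset.2 ?_)
  refine ⟨y * k, ⟨k, hk, rfl⟩, ?_⟩
  change (y * k)⁻¹ * (((n.1 : (quasiSplit F E c 3).arithmeticSubgroup) * γ₀ : (quasiSplit F E c 3).arithmeticSubgroup) :
      (quasiSplit F E c 3).Adelic) * (y * k) ∈ tsupport f
  rw [conj_mul_mul_eq]
  exact subset_tsupport _ hne

/-- **The centre family has compact support in `(k, w)`**: for `f` of compact support, compact `K ⊆ G(𝔸_F)` and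
`y ∈ G(𝔸_F)`, the function `(k, w) ↦ f(k⁻¹ y⁻¹ (γ₀ n(w)) y k)` on `K × 𝔸_E⁻` vanishes off `K × W` for a compact
`W ⊆ 𝔸_E⁻` (the conjugates `k (tsupport f) k⁻¹`, `k ∈ K`, fill a compact set; `w ↦ y⁻¹ γ₀ n(w) y` is a closed embedding, ★
`isClosedEmbedding_basePoint_mul_heisElt`). [cite: Rogawski1990, §7.2 (7.2.5) (p. 94)] -/
theorem exists_isCompact_forall_centre_conj_eq_zero {V : Type*} [Zero V] [TopologicalSpace V] (hc : c * c = 1)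
    (γ₀ : (quasiSplit F E c 3).Adelic) {KU : Set (quasiSplit F E c 3).Adelic} (hK : IsCompact KU)
    {f : (quasiSplit F E c 3).Adelic → V} (hf : HasCompactSupport f) (y : (quasiSplit F E c 3).Adelic) :
    ∃ W : Set (traceZeroAdele F E c), IsCompact W ∧ ∀ k ∈ KU, ∀ w ∉ W,
      f (k⁻¹ * (y⁻¹ * (γ₀ *
        (((heisElt hc 0 w : unipotentInBorel F E c 3) : borelAdelic F E c 3) : (quasiSplit F E c 3).Adelic)) * y) * k) = 0 := by
  haveI : T2Space (quasiSplit F E c 3).Adelic := inferInstanceAs (T2Space (adelic F E c 3 ((StdForm.antidiagonal 3).over E)))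
  -- the compact set `D = ⋃_{k ∈ K} k (tsupport f) k⁻¹`
  set D : Set (quasiSplit F E c 3).Adelic :=
    (fun p : (quasiSplit F E c 3).Adelic × (quasiSplit F E c 3).Adelic => p.1 * p.2 * p.1⁻¹) '' (KU ×ˢ tsupport f) with hD
  have hDc : IsCompact D := (hK.prod hf.isCompact).image
    ((continuous_fst.mul continuous_snd).mul continuous_fst.inv)
  -- the closed embedding `p ↦ y⁻¹ γ₀ n(p) y`
  have hP : IsClosedEmbedding fun p : AdeleRing (𝓞 E) E × traceZeroAdele F E c =>
      y⁻¹ * γ₀ * (((heisElt hc p.1 p.2 : unipotentInBorel F E c 3) : borelAdelic F E c 3) : (quasiSplit F E c 3).Adelic) * y :=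
    (Homeomorph.mulRight y).isClosedEmbedding.comp (isClosedEmbedding_basePoint_mul_heisElt hc (y⁻¹ * γ₀))
  set W : Set (traceZeroAdele F E c) := Prod.snd '' ((fun p : AdeleRing (𝓞 E) E × traceZeroAdele F E c =>
      y⁻¹ * γ₀ * (((heisElt hc p.1 p.2 : unipotentInBorel F E c 3) : borelAdelic F E c 3) : (quasiSplit F E c 3).Adelic) * y) ⁻¹' D)
    with hW
  refine ⟨W, (hP.isCompact_preimage hDc).image continuous_snd, fun k hk w hw => ?_⟩
  by_contra hne
  refine hw ⟨((0 : AdeleRing (𝓞 E) E), w), ?_, rfl⟩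
  change y⁻¹ * γ₀ * (((heisElt hc 0 w : unipotentInBorel F E c 3) : borelAdelic F E c 3) : (quasiSplit F E c 3).Adelic) * y ∈ D
  refine ⟨(k, k⁻¹ * (y⁻¹ * (γ₀ *
    (((heisElt hc 0 w : unipotentInBorel F E c 3) : borelAdelic F E c 3) : (quasiSplit F E c 3).Adelic)) * y) * k),
    ⟨hk, subset_tsupport _ hne⟩, ?_⟩
  change k * (k⁻¹ * (y⁻¹ * (γ₀ * _) * y) * k) * k⁻¹ = _
  group

section Integral

variable [MeasurableSpace (quasiSplit F E c 3).Adelic] [BorelSpace (quasiSplit F E c 3).Adelic]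
  [MeasurableSpace (AdeleRing (𝓞 E) E)] [BorelSpace (AdeleRing (𝓞 E) E)]

/-- **The centre family `(k, w) ↦ f(k⁻¹ y⁻¹ (γ₀ n(w)) y k)` is integrable on `K × 𝔸_E⁻`** (continuous of compact support,
for `μ_K` finite and `μ_Y` a Haar measure). [cite: Rogawski1990, §7.2 (7.2.5) (p. 94)] -/
theorem integrable_uncurry_centre_conj (hc : c * c = 1) (γ₀ : (quasiSplit F E c 3).Adelic)
    {KU : Subgroup (quasiSplit F E c 3).Adelic} (hK : IsCompact (KU : Set (quasiSplit F E c 3).Adelic))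
    (μK : Measure KU) [IsFiniteMeasure μK]
    (μY : Measure (traceZeroAdele F E c)) [μY.IsAddHaarMeasure]
    {f : (quasiSplit F E c 3).Adelic → ℂ} (hf : HasCompactSupport f) (hfc : Continuous f) (y : (quasiSplit F E c 3).Adelic) :
    Integrable (uncurry fun (k : KU) (w : traceZeroAdele F E c) =>
      f ((k : (quasiSplit F E c 3).Adelic)⁻¹ * (y⁻¹ * (γ₀ *
        (((heisElt hc 0 w : unipotentInBorel F E c 3) : borelAdelic F E c 3) : (quasiSplit F E c 3).Adelic)) * y) *
          (k : (quasiSplit F E c 3).Adelic))) (μK.prod μY) := by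
  haveI := t2Space_adeleRing_of_numberField E
  haveI := secondCountableTopology_adeleRing E
  haveI : SecondCountableTopology (quasiSplit F E c 3).Adelic :=
    inferInstanceAs (SecondCountableTopology (adelic F E c 3 ((StdForm.antidiagonal 3).over E)))
  haveI : CompactSpace KU := isCompact_iff_compactSpace.1 hK
  haveI : SecondCountableTopology KU := TopologicalSpace.Subtype.secondCountableTopology (KU : Set (quasiSplit F E c 3).Adelic)
  haveI : BorelSpace KU := Subtype.borelSpace _
  haveI : SecondCountableTopology (traceZeroAdele F E c) := TopologicalSpace.Subtype.secondCountableTopology _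
  haveI : BorelSpace (traceZeroAdele F E c) := Subtype.borelSpace _
  obtain ⟨W, hWc, hW⟩ := exists_isCompact_forall_centre_conj_eq_zero (F := F) (E := E) (c := c) hc γ₀ hK hf y
  have hcont : Continuous (uncurry fun (k : KU) (w : traceZeroAdele F E c) =>
      f ((k : (quasiSplit F E c 3).Adelic)⁻¹ * (y⁻¹ * (γ₀ *
        (((heisElt hc 0 w : unipotentInBorel F E c 3) : borelAdelic F E c 3) : (quasiSplit F E c 3).Adelic)) * y) *
          (k : (quasiSplit F E c 3).Adelic))) := by
    refine hfc.comp ?_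
    have hn : Continuous fun w : traceZeroAdele F E c =>
        (((heisElt hc 0 w : unipotentInBorel F E c 3) : borelAdelic F E c 3) : (quasiSplit F E c 3).Adelic) :=
      (continuous_subtype_val.comp continuous_subtype_val).comp
        ((continuous_heisElt hc).comp (continuous_const.prodMk continuous_id))
    exact ((continuous_subtype_val.comp continuous_fst).inv.mul
      ((continuous_const.mul (continuous_const.mul (hn.comp continuous_snd))).mul continuous_const)).mul
      (continuous_subtype_val.comp continuous_fst)
  have hsupp : HasCompactSupport (uncurry fun (k : KU) (w : traceZeroAdele F E c) =>
      f ((k : (quasiSplit F E c 3).Adelic)⁻¹ * (y⁻¹ * (γ₀ *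
        (((heisElt hc 0 w : unipotentInBorel F E c 3) : borelAdelic F E c 3) : (quasiSplit F E c 3).Adelic)) * y) *
          (k : (quasiSplit F E c 3).Adelic))) := by
    refine HasCompactSupport.intro (isCompact_univ.prod hWc) ?_
    rintro ⟨k, w⟩ hkw
    have hw : w ∉ W := fun h => hkw (Set.mk_mem_prod (Set.mem_univ _) h)
    exact hW k k.2 w hw
  exact hcont.integrable_of_hasCompactSupport hsupp

/-! ## §2 HEAD: the `K`-average of the bracket is the bracket of the `K`-averaged test function -/

/-- **`∫_K b_T[f](y k) dμ_K(k) = b_T[f^K](y)`, `f^K(z) = ∫_K f(k⁻¹ z k) dμ_K(k)`** — for a compact subgroup `K ≤ G(𝔸_F)`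
preserving the Borel height (`hH`), a finite measure `μ_K` on `K`, `f` continuous of compact support, every truncation
`T` and every `y ∈ G(𝔸_F)`. The lattice sum is finite on `y K` (§1), so `∫_K Σ' = Σ' ∫_K`; the truncation indicator
`1_{T < H(y k)} = 1_{T < H(y)}` is constant in `k`; the centre integral swaps with `∫_K` by Fubini on the compactly
supported continuous family of §1. This is the step `∫_K … dk ↦ f^K` of (7.2.3)–(7.2.5).
[cite: Rogawski1990, §7.2 Prop. 7.2.1, (7.2.3)–(7.2.5) (pp. 92–94)] [cite: Arthur1981TraceFormulaInvariantForm, §2] -/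
theorem integral_singularBracket_mul_eq_singularBracket_kAverage (hc : c * c = 1)
    (γ₀ : (quasiSplit F E c 3).arithmeticSubgroup)
    {KU : Subgroup (quasiSplit F E c 3).Adelic} (hK : IsCompact (KU : Set (quasiSplit F E c 3).Adelic))
    (μK : Measure KU) [IsFiniteMeasure μK]
    (hH : ∀ (z : (quasiSplit F E c 3).Adelic) (k : KU), borelHeight (z * (k : (quasiSplit F E c 3).Adelic)) = borelHeight z)
    (μY : Measure (traceZeroAdele F E c)) [μY.IsAddHaarMeasure] [SFinite μY]
    {f : (quasiSplit F E c 3).Adelic → ℂ} (hf : HasCompactSupport f) (hfc : Continuous f) (T : ℝ≥0)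
    (y : (quasiSplit F E c 3).Adelic) :
    ∫ k : KU,
      ((∑' n : {n : ↥((adelicUnipotent F E c 3).subgroupOf (quasiSplit F E c 3).arithmeticSubgroup ⊓
            Subgroup.centralizer ({γ₀} : Set (quasiSplit F E c 3).arithmeticSubgroup)) // n ≠ 1},
          f ((y * (k : (quasiSplit F E c 3).Adelic))⁻¹ *
            (((n.1 : (quasiSplit F E c 3).arithmeticSubgroup) * γ₀ : (quasiSplit F E c 3).arithmeticSubgroup) :
              (quasiSplit F E c 3).Adelic) * (y * (k : (quasiSplit F E c 3).Adelic)))) -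
        Set.indicator {z : (quasiSplit F E c 3).Adelic | T < borelHeight z}
          (fun z => (μY (traceZeroFundamentalDomain F E c)).toReal⁻¹ • ∫ w : traceZeroAdele F E c,
            f (z⁻¹ * ((γ₀ : (quasiSplit F E c 3).Adelic) *
              (((heisElt hc 0 w : unipotentInBorel F E c 3) : borelAdelic F E c 3) : (quasiSplit F E c 3).Adelic)) * z) ∂μY)
          (y * (k : (quasiSplit F E c 3).Adelic))) ∂μK =
      (∑' n : {n : ↥((adelicUnipotent F E c 3).subgroupOf (quasiSplit F E c 3).arithmeticSubgroup ⊓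
            Subgroup.centralizer ({γ₀} : Set (quasiSplit F E c 3).arithmeticSubgroup)) // n ≠ 1},
          ∫ k : KU, f ((k : (quasiSplit F E c 3).Adelic)⁻¹ * (y⁻¹ *
            (((n.1 : (quasiSplit F E c 3).arithmeticSubgroup) * γ₀ : (quasiSplit F E c 3).arithmeticSubgroup) :
              (quasiSplit F E c 3).Adelic) * y) * (k : (quasiSplit F E c 3).Adelic)) ∂μK) -
        Set.indicator {z : (quasiSplit F E c 3).Adelic | T < borelHeight z}
          (fun z => (μY (traceZeroFundamentalDomain F E c)).toReal⁻¹ • ∫ w : traceZeroAdele F E c,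
            (∫ k : KU, f ((k : (quasiSplit F E c 3).Adelic)⁻¹ * (z⁻¹ * ((γ₀ : (quasiSplit F E c 3).Adelic) *
              (((heisElt hc 0 w : unipotentInBorel F E c 3) : borelAdelic F E c 3) : (quasiSplit F E c 3).Adelic)) * z) *
                (k : (quasiSplit F E c 3).Adelic)) ∂μK) ∂μY) y := by
  classical
  haveI : T2Space (quasiSplit F E c 3).Adelic := inferInstanceAs (T2Space (adelic F E c 3 ((StdForm.antidiagonal 3).over E)))
  haveI : SecondCountableTopology (quasiSplit F E c 3).Adelic :=
    inferInstanceAs (SecondCountableTopology (adelic F E c 3 ((StdForm.antidiagonal 3).over E)))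
  haveI : CompactSpace KU := isCompact_iff_compactSpace.1 hK
  haveI : SecondCountableTopology KU := TopologicalSpace.Subtype.secondCountableTopology (KU : Set (quasiSplit F E c 3).Adelic)
  haveI : BorelSpace KU := Subtype.borelSpace _
  -- abbreviations
  set X : {n : ↥((adelicUnipotent F E c 3).subgroupOf (quasiSplit F E c 3).arithmeticSubgroup ⊓
        Subgroup.centralizer ({γ₀} : Set (quasiSplit F E c 3).arithmeticSubgroup)) // n ≠ 1} → (quasiSplit F E c 3).Adelic :=
    fun n => (((n.1 : (quasiSplit F E c 3).arithmeticSubgroup) * γ₀ : (quasiSplit F E c 3).arithmeticSubgroup) :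
      (quasiSplit F E c 3).Adelic) with hX
  set Gc : KU → traceZeroAdele F E c → ℂ := fun k w =>
    f ((k : (quasiSplit F E c 3).Adelic)⁻¹ * (y⁻¹ * ((γ₀ : (quasiSplit F E c 3).Adelic) *
      (((heisElt hc 0 w : unipotentInBorel F E c 3) : borelAdelic F E c 3) : (quasiSplit F E c 3).Adelic)) * y) *
        (k : (quasiSplit F E c 3).Adelic)) with hGc
  -- §1: the finite set of lattice points and the integrable centre family
  obtain ⟨S, hS⟩ := exists_finset_forall_singularLattice_conj_eq_zero (F := F) (E := E) (c := c) γ₀ hK hf y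
  have hGint : Integrable (uncurry Gc) (μK.prod μY) :=
    integrable_uncurry_centre_conj hc (γ₀ : (quasiSplit F E c 3).Adelic) hK μK μY hf hfc y
  -- each `k ↦ f(k⁻¹ Z k)` is integrable on the compact `K`
  have hint1 : ∀ Z : (quasiSplit F E c 3).Adelic, Integrable (fun k : KU =>
      f ((k : (quasiSplit F E c 3).Adelic)⁻¹ * Z * (k : (quasiSplit F E c 3).Adelic))) μK := fun Z => by
    have hcont : Continuous fun k : KU => f ((k : (quasiSplit F E c 3).Adelic)⁻¹ * Z * (k : (quasiSplit F E c 3).Adelic)) :=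
      hfc.comp ((continuous_subtype_val.inv.mul continuous_const).mul continuous_subtype_val)
    exact hcont.integrable_of_hasCompactSupport
      (IsCompact.of_isClosed_subset isCompact_univ (isClosed_tsupport _) (Set.subset_univ _))
  -- the lattice term, pointwise in `k`: a finite sum
  have hsum : ∀ k : KU, (∑' n, f ((y * (k : (quasiSplit F E c 3).Adelic))⁻¹ * X n * (y * (k : (quasiSplit F E c 3).Adelic)))) =
      ∑ n ∈ S, f ((k : (quasiSplit F E c 3).Adelic)⁻¹ * (y⁻¹ * X n * y) * (k : (quasiSplit F E c 3).Adelic)) := fun k => by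
    rw [tsum_eq_sum (s := S) (fun n hn => by rw [conj_mul_mul_eq]; exact hS k k.2 n hn)]
    exact Finset.sum_congr rfl fun n _ => by rw [conj_mul_mul_eq]
  -- the `K`-averaged lattice term: the same finite sum
  have hsumK : (∑' n, ∫ k : KU, f ((k : (quasiSplit F E c 3).Adelic)⁻¹ * (y⁻¹ * X n * y) * (k : (quasiSplit F E c 3).Adelic)) ∂μK) =
      ∑ n ∈ S, ∫ k : KU, f ((k : (quasiSplit F E c 3).Adelic)⁻¹ * (y⁻¹ * X n * y) * (k : (quasiSplit F E c 3).Adelic)) ∂μK := by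
    refine tsum_eq_sum (s := S) (fun n hn => ?_)
    rw [show (fun k : KU => f ((k : (quasiSplit F E c 3).Adelic)⁻¹ * (y⁻¹ * X n * y) * (k : (quasiSplit F E c 3).Adelic))) =
      fun _ => 0 from funext fun k => hS k k.2 n hn, integral_zero]
  -- the indicator is constant in `k`
  have hind : ∀ (k : KU) (Φ : (quasiSplit F E c 3).Adelic → ℂ),
      Set.indicator {z : (quasiSplit F E c 3).Adelic | T < borelHeight z} Φ (y * (k : (quasiSplit F E c 3).Adelic)) =
        if T < borelHeight y then Φ (y * (k : (quasiSplit F E c 3).Adelic)) else 0 := fun k Φ => by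
    by_cases hT : T < borelHeight y
    · rw [if_pos hT, Set.indicator_of_mem]
      change T < borelHeight (y * (k : (quasiSplit F E c 3).Adelic))
      rwa [hH]
    · rw [if_neg hT, Set.indicator_of_notMem]
      change ¬ T < borelHeight (y * (k : (quasiSplit F E c 3).Adelic))
      rwa [hH]
  -- the centre integrand at `y k` is `Gc k`
  have hcentre : ∀ (k : KU) (w : traceZeroAdele F E c),
      f ((y * (k : (quasiSplit F E c 3).Adelic))⁻¹ * ((γ₀ : (quasiSplit F E c 3).Adelic) *
        (((heisElt hc 0 w : unipotentInBorel F E c 3) : borelAdelic F E c 3) : (quasiSplit F E c 3).Adelic)) *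
          (y * (k : (quasiSplit F E c 3).Adelic))) = Gc k w := fun k w => by
    simp only [hGc, conj_mul_mul_eq]
  -- rewrite the left integrand
  have hL : (fun k : KU =>
      ((∑' n, f ((y * (k : (quasiSplit F E c 3).Adelic))⁻¹ * X n * (y * (k : (quasiSplit F E c 3).Adelic)))) -
        Set.indicator {z : (quasiSplit F E c 3).Adelic | T < borelHeight z}
          (fun z => (μY (traceZeroFundamentalDomain F E c)).toReal⁻¹ • ∫ w : traceZeroAdele F E c,
            f (z⁻¹ * ((γ₀ : (quasiSplit F E c 3).Adelic) *
              (((heisElt hc 0 w : unipotentInBorel F E c 3) : borelAdelic F E c 3) : (quasiSplit F E c 3).Adelic)) * z) ∂μY)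
          (y * (k : (quasiSplit F E c 3).Adelic)))) =
      fun k : KU => (∑ n ∈ S, f ((k : (quasiSplit F E c 3).Adelic)⁻¹ * (y⁻¹ * X n * y) * (k : (quasiSplit F E c 3).Adelic))) -
        (if T < borelHeight y then (μY (traceZeroFundamentalDomain F E c)).toReal⁻¹ • ∫ w, Gc k w ∂μY else 0) := by
    funext k
    rw [hsum k, hind k]
    simp only [hcentre]
  rw [hL, integral_sub (integrable_finsetSum _ fun n _ => hint1 _) ?_, integral_finsetSum _ fun n _ => hint1 _, ← hsumK]
  swap
  · by_cases hT : T < borelHeight y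
    · simp only [if_pos hT]
      exact hGint.integral_prod_left.smul ((μY (traceZeroFundamentalDomain F E c)).toReal⁻¹)
    · simp only [if_neg hT]
      exact integrable_zero _ _ _
  congr 1
  -- the centre term
  by_cases hT : T < borelHeight y
  · rw [Set.indicator_of_mem (show y ∈ {z : (quasiSplit F E c 3).Adelic | T < borelHeight z} from hT)]
    simp only [if_pos hT]
    rw [integral_smul, integral_integral_swap hGint]
  · rw [Set.indicator_of_notMem (show y ∉ {z : (quasiSplit F E c 3).Adelic | T < borelHeight z} from hT)]
    simp only [if_neg hT, integral_zero]

end Integral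

/-! ## §3 `f^K` is again continuous of compact support -/

section KAverage

variable [MeasurableSpace (quasiSplit F E c 3).Adelic] [BorelSpace (quasiSplit F E c 3).Adelic]

/-- **`f^K : z ↦ ∫_K f(k⁻¹ z k) dμ_K` is continuous** for `f` continuous, `K` compact and `μ_K` finite (a parametric integral
of a jointly continuous integrand over a compact set, Mathlib `continuous_parametric_integral_of_continuous`).
[cite: Rogawski1990, §7.2 (7.2.5) (p. 94)] -/
theorem continuous_kConjAverage {KU : Subgroup (quasiSplit F E c 3).Adelic} (hK : IsCompact (KU : Set (quasiSplit F E c 3).Adelic))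
    (μK : Measure KU) [IsFiniteMeasure μK] {V : Type*} [NormedAddCommGroup V] [NormedSpace ℝ V]
    {f : (quasiSplit F E c 3).Adelic → V} (hfc : Continuous f) :
    Continuous fun z : (quasiSplit F E c 3).Adelic =>
      ∫ k : KU, f ((k : (quasiSplit F E c 3).Adelic)⁻¹ * z * (k : (quasiSplit F E c 3).Adelic)) ∂μK := by
  haveI : LocallyCompactSpace (quasiSplit F E c 3).Adelic :=
    inferInstanceAs (LocallyCompactSpace (adelic F E c 3 ((StdForm.antidiagonal 3).over E)))
  haveI : SecondCountableTopology (quasiSplit F E c 3).Adelic :=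
    inferInstanceAs (SecondCountableTopology (adelic F E c 3 ((StdForm.antidiagonal 3).over E)))
  haveI : CompactSpace KU := isCompact_iff_compactSpace.1 hK
  haveI : SecondCountableTopology KU := TopologicalSpace.Subtype.secondCountableTopology (KU : Set (quasiSplit F E c 3).Adelic)
  haveI : BorelSpace KU := Subtype.borelSpace _
  have h := continuous_parametric_integral_of_continuous (μ := μK)
    (f := fun (z : (quasiSplit F E c 3).Adelic) (k : KU) =>
      f ((k : (quasiSplit F E c 3).Adelic)⁻¹ * z * (k : (quasiSplit F E c 3).Adelic)))
    (hfc.comp (((continuous_subtype_val.comp continuous_snd).inv.mul continuous_fst).mul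
      (continuous_subtype_val.comp continuous_snd))) isCompact_univ
  simpa only [Measure.restrict_univ] using h

omit [MeasurableSpace (quasiSplit F E c 3).Adelic] [BorelSpace (quasiSplit F E c 3).Adelic] in
/-- **`f^K` has compact support**: `f^K(z) ≠ 0` forces `k⁻¹ z k ∈ tsupport f` for some `k ∈ K`, i.e. `z ∈ K (tsupport f) K⁻¹`,
a compact set. [cite: Rogawski1990, §7.2 (7.2.5) (p. 94)] -/
theorem hasCompactSupport_kConjAverage [MeasurableSpace (quasiSplit F E c 3).Adelic]
    {KU : Subgroup (quasiSplit F E c 3).Adelic} (hK : IsCompact (KU : Set (quasiSplit F E c 3).Adelic))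
    (μK : Measure KU) {V : Type*} [NormedAddCommGroup V] [NormedSpace ℝ V]
    {f : (quasiSplit F E c 3).Adelic → V} (hf : HasCompactSupport f) :
    HasCompactSupport fun z : (quasiSplit F E c 3).Adelic =>
      ∫ k : KU, f ((k : (quasiSplit F E c 3).Adelic)⁻¹ * z * (k : (quasiSplit F E c 3).Adelic)) ∂μK := by
  haveI : T2Space (quasiSplit F E c 3).Adelic := inferInstanceAs (T2Space (adelic F E c 3 ((StdForm.antidiagonal 3).over E)))
  -- the compact set `D = ⋃_{k ∈ K} k (tsupport f) k⁻¹`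
  have hDc : IsCompact ((fun p : (quasiSplit F E c 3).Adelic × (quasiSplit F E c 3).Adelic => p.1 * p.2 * p.1⁻¹) ''
      ((KU : Set (quasiSplit F E c 3).Adelic) ×ˢ tsupport f)) :=
    (hK.prod hf.isCompact).image ((continuous_fst.mul continuous_snd).mul continuous_fst.inv)
  refine HasCompactSupport.intro hDc fun z hz => ?_
  have hzero : (fun k : KU => f ((k : (quasiSplit F E c 3).Adelic)⁻¹ * z * (k : (quasiSplit F E c 3).Adelic))) = fun _ => 0 := by
    funext k
    by_contra hne
    refine hz ⟨((k : (quasiSplit F E c 3).Adelic), (k : (quasiSplit F E c 3).Adelic)⁻¹ * z * (k : (quasiSplit F E c 3).Adelic)),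
      ⟨k.2, subset_tsupport _ hne⟩, ?_⟩
    change (k : (quasiSplit F E c 3).Adelic) * ((k : (quasiSplit F E c 3).Adelic)⁻¹ * z * (k : (quasiSplit F E c 3).Adelic)) *
      (k : (quasiSplit F E c 3).Adelic)⁻¹ = z
    group
  rw [hzero, integral_zero]

end KAverage

end UnitaryGroup

end Literature.NumberTheory.Automorphic
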